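import Literature.AlgebraicGeometry.Motives.JacobianThetaDivisor
import Literature.AlgebraicGeometry.Motives.AbelianVarietyLevelAdjointTranslates
import Literature.AlgebraicGeometry.Motives.CartierDivisorEffective
import HarnessLib

/-!
# Translates of principal polarisation divisors and of Riemann theta divisors

Layer `Literature/AlgebraicGeometry/Motives`, namespaces `….Motives.AbelianVariety` (§1–§2) and `….Motives.Jacobian` (§3).
KERNEL ONLY (theorems; no definition, no named fact, no instance, no `sorry`).  Sequel of ★
`Motives/AbelianVarietyLevelAdjointTranslates` (the theorem of the square on `D_Q` and on `ē_N`) and companion of ★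
`Motives/JacobianThetaDivisorOfCurveIso` (the same three transports along ISOMORPHISMS OF ABELIAN VARIETIES / of curves;
here along the TRANSLATION `t_R : A ⥲ A`, which is an isomorphism of the underlying scheme but not a homomorphism).

## The mathematics

Let `A` be an abelian variety over a field `K`, `Θ` a Cartier divisor on `A` and `R ∈ A(K)`.  By the theorem of the
square, `D_P(t_R^*Θ) = t_P^* t_R^*Θ − t_R^*Θ` is the same divisor as `t_R^* D_P(Θ)`, which is linearly equivalent to
`D_P(Θ)` (Mumford §6 Cor. 4, §8: `φ_{t_x^*L} = φ_L`).  Hence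

* §1 `K(t_R^*Θ) = K(Θ)` — ON THE NOSE as subgroups of `A(K)` (`K(Θ) = {P ; D_P(Θ) ∼ 0}`, Mumford §6 Definition p. 60);
* §2 a translate of a PRINCIPAL POLARISATION DIVISOR (ample, `K(Θ)(K) = 1`) is again one (ampleness pulls back along the
  affine dominant isomorphism `t_R`, ★ `CartierDivisor.IsAmple.pullback`; Lange §2.1.1: the type is a translation invariant);
* §3 for a Jacobian `𝒥` of a curve, a translate of a RIEMANN THETA DIVISOR (effective, support `t_x(W̃_{g−1}(P))`) is again one:
  `t_R^*Θ` is effective and its support is `t_R⁻¹(t_x W̃_{g−1}(P)) = t_{R⁻¹x}(W̃_{g−1}(P))` (Milne JV §6: «if `P` is replaced by a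
  second point, `Θ` is replaced by a translate»; Lange Cor. 4.2.4 `W̃_{g−1} = t_x^*Θ`).

## What is proved
§1 `AbelianVariety.weilDiv_pullback_translation_linEquiv` (`D_P(t_R^*Θ) ∼ D_P(Θ)`), **`AbelianVariety.KTheta_pullback_translation`**
(`K(t_R^*Θ) = K(Θ)`); §2 **`AbelianVariety.IsPrincipalPolarizationDivisor.pullback_translation`**; §3
`AbelianVariety.preimage_translation_eq_image_translation_inv` (`t_R⁻¹(S) = t_{R⁻¹}(S)` on the underlying space; private
point/image helpers), **`Jacobian.IsRiemannThetaDivisor.pullback_translation`**.  Use (cell `hodgecm-mathlib`, D-0151; crux HLiu418 =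
stmt-HodgeConjecture-24832, interface row VI-8, route G3 = the (Θ-uniq) chain, leaf (iv′) of the socket letters of record): the
glue «two principal Riemann theta divisors of one Jacobian have equal level pairings» moves both divisors by translations; these
three transports are its bookkeeping.  COUNT-NEUTRAL; nothing here proves (Θ-uniq).  HC_CM is proved only modulo the 7 printed
citations until rung 0 closes; this file moves no book by itself.

## References
* [MumfordAV1970] D. Mumford, *Abelian Varieties* (1970), §6 (Definition of `K(L)`, p. 60; Cor. 4, p. 59), §8 (pp. 74–75, `φ_L`).
* [Lange2023AbelianVarietiesComplex] H. Lange, *Abelian Varieties over the Complex Numbers* (2023), §2.1.1 (p. 68), §1.4.2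
  Prop. 1.4.7, §4.2.1 Cor. 4.2.4, §4.2.2 Thm. 4.2.5.
* [Milne1986JacobianVarieties] J. S. Milne, *Jacobian Varieties* (1986), §6 (`Θ = W^{g−1}`, before Thm. 6.6).
* [GortzWedhorn2023] U. Görtz, T. Wedhorn, *Algebraic Geometry II* (2023), Def./Rem. 27.1 (translations, pp. 604–605).
-/

set_option autoImplicit false

noncomputable section

open CategoryTheory AlgebraicGeometry

universe u

namespace Literature.AlgebraicGeometry.Motives

namespace AbelianVariety

variable {K : Type u} [Field K] (A : AbelianVariety K)

/-! ## §1 `K(t_R^*Θ) = K(Θ)` -/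

/-- **`D_P(t_R^*Θ) ∼ D_P(Θ)`**: `D_P(t_R^*Θ)` is the same divisor as `t_R^* D_P(Θ)` (translations commute, ★
`weilDiv_pullback_translation_sameDivisor`), and `t_R^* D_P(Θ) ∼ D_P(Θ)` by the theorem of the square (★
`pullback_translation_weilDiv_linEquiv`).  Mumford §8: `φ_{t_x^*L} = φ_L`.
[cite: MumfordAV1970, §6 Cor. 4 (p. 59) and §8 (pp. 74–75)] -/
theorem weilDiv_pullback_translation_linEquiv (Θ : CartierDivisor A.X.left) (P R : A.Points K) :
    (A.weilDiv (Θ.pullback (A.translation R).left) P).LinEquiv (A.weilDiv Θ P) :=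
  (weilDiv_pullback_translation_sameDivisor Θ P R).linEquiv.trans (pullback_translation_weilDiv_linEquiv Θ P R)

/-- **`K(t_R^*Θ) = K(Θ)`** as subgroups of `A(K)`: `P ∈ K(Θ)` iff `D_P(Θ) ∼ 0` (★ `mem_KTheta_iff`), and
`D_P(t_R^*Θ) ∼ D_P(Θ)` (`weilDiv_pullback_translation_linEquiv`).  Mumford §6: `K(L)` for `L = 𝒪(Θ)` depends only on the
class of `L` under `φ`, and `φ_{t_x^*L} = φ_L` (§8). [cite: MumfordAV1970, §6 Definition (p. 60) and §8] -/
theorem KTheta_pullback_translation (Θ : CartierDivisor A.X.left) (R : A.Points K) :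
    A.KTheta (Θ.pullback (A.translation R).left) = A.KTheta Θ := by
  ext P
  rw [mem_KTheta_iff, mem_KTheta_iff]
  have h := A.weilDiv_pullback_translation_linEquiv Θ P R
  exact ⟨fun hP => h.symm.trans hP, fun hP => h.trans hP⟩

variable {A}

/-! ## §2 Translates of principal polarisation divisors -/

/-- **A translate of a principal polarisation divisor is a principal polarisation divisor**: `t_R^*Θ` is ample — `t_R` is an
isomorphism of the underlying scheme, hence affine and dominant, ★ `CartierDivisor.IsAmple.pullback` — and
`K(t_R^*Θ)(K) = K(Θ)(K) = 1` (`KTheta_pullback_translation`).  Lange §2.1.1: the type of a polarisation is unchanged by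
translation (`φ_{t_x^*L} = φ_L`). [cite: Lange2023AbelianVarietiesComplex, §2.1.1 (p. 68) and §1.4.2 Prop. 1.4.7]
[cite: MumfordAV1970, §6 Definition (p. 60) and §8] -/
theorem IsPrincipalPolarizationDivisor.pullback_translation {Θ : CartierDivisor A.X.left}
    (h : A.IsPrincipalPolarizationDivisor Θ) (R : A.Points K) :
    A.IsPrincipalPolarizationDivisor (Θ.pullback (A.translation R).left) :=
  ⟨h.isAmple.pullback (A.translation R).left, (A.KTheta_pullback_translation Θ R).trans h.KTheta_eq_bot⟩

/-! ## §3 Translates of Riemann theta divisors -/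

/-- `t_R (t_{R⁻¹} y) = y` on the underlying space. [cite: GortzWedhorn2023, Def./Rem. 27.1 (pp. 604–605)] -/
private theorem translation_base_translation_inv_base (R : A.Points K) (y : A.X.left) :
    (A.translation R).left.base ((A.translation R⁻¹).left.base y) = y := by
  change ((A.translation R⁻¹).left ≫ (A.translation R).left) y = y
  rw [← Over.comp_left, translation_inv_comp_translation]
  rfl

/-- `t_{R⁻¹} (t_R y) = y` on the underlying space. [cite: GortzWedhorn2023, Def./Rem. 27.1 (pp. 604–605)] -/
private theorem translation_inv_base_translation_base (R : A.Points K) (y : A.X.left) :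
    (A.translation R⁻¹).left.base ((A.translation R).left.base y) = y := by
  change ((A.translation R).left ≫ (A.translation R⁻¹).left) y = y
  rw [← Over.comp_left, translation_comp_translation_inv]
  rfl

/-- **`t_R⁻¹(S) = t_{R⁻¹}(S)`** on the underlying space of `A`: the translation `t_R` is a bijection with inverse `t_{R⁻¹}`
(★ `translation_comp_translation_inv` / `translation_inv_comp_translation`), so preimages under `t_R` are images under
`t_{R⁻¹}`. [cite: GortzWedhorn2023, Def./Rem. 27.1 (pp. 604–605)] -/
theorem preimage_translation_eq_image_translation_inv (R : A.Points K) (S : Set A.X.left) :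
    (A.translation R).left.base ⁻¹' S = (A.translation R⁻¹).left.base '' S :=
  (congrFun (Set.image_eq_preimage_of_inverse (f := (A.translation R⁻¹).left.base) (g := (A.translation R).left.base)
    (translation_base_translation_inv_base R) (translation_inv_base_translation_base R)) S).symm

/-- `t_Q(t_P(S)) = t_{QP}(S)` on the underlying space (★ `translation_comp`: `t_P ≫ t_Q = t_{QP}`); a `private` copy, in the
`.left.base` spelling used by `IsRiemannThetaDivisor`, of ★ `AbelianVariety.image_translation_image_translation` of
`Motives/JacobianAbelJacobiTranslates` (not imported: that module carries the strictly-perfect-resolution machinery).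
[cite: GortzWedhorn2023, Def./Rem. 27.1 (pp. 604–605)] -/
private theorem image_translation_image_translation_base (P Q : A.Points K) (S : Set A.X.left) :
    (A.translation Q).left.base '' ((A.translation P).left.base '' S) = (A.translation (Q * P)).left.base '' S := by
  rw [Set.image_image]
  refine Set.image_congr' fun z => ?_
  change ((A.translation P).left ≫ (A.translation Q).left) z = _
  rw [← Over.comp_left, translation_comp]

end AbelianVariety

namespace Jacobian

variable {k : Type u} [Field k] {C : SchemeOver k} {𝒥 : Jacobian C}

/-- **A translate of a Riemann theta divisor is a Riemann theta divisor.**  If `Θ` is effective with support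
`J ∖ J_1 = t_x(W̃_{g−1}(P))`, then `t_R^*Θ` is effective (★ `CartierDivisor.IsEffective.pullback`) and its support is the
preimage `t_R⁻¹(J ∖ J_1)` (★ `CartierDivisor.preimage_nonvanishing` for the canonical section `1`, `t_R^♯ 1 = 1`), i.e.
`t_{R⁻¹}(t_x(W̃_{g−1}(P))) = t_{R⁻¹x}(W̃_{g−1}(P))`: same base point `P`, translation parameter `R⁻¹·x`.  Milne JV §6: «if `P`
is replaced by a second `k`-rational point, `Θ` is replaced by a translate»; Lange Cor. 4.2.4: `W̃_{g−1} = t_x^*Θ`.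
[cite: Milne1986JacobianVarieties, §6 (Θ = W^{g-1}, before Thm. 6.6)]
[cite: Lange2023AbelianVarietiesComplex, §4.2.1 Cor. 4.2.4 and §4.2.2 Thm. 4.2.5] -/
theorem IsRiemannThetaDivisor.pullback_translation {Θ : CartierDivisor 𝒥.J.X.left} (h : 𝒥.IsRiemannThetaDivisor Θ)
    (R : 𝒥.J.Points k) : 𝒥.IsRiemannThetaDivisor (Θ.pullback (𝒥.J.translation R).left) := by
  refine ⟨h.isEffective.pullback _, ?_⟩
  obtain ⟨P, x, hsupp⟩ := h.exists_support_eq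
  refine ⟨P, R⁻¹ * x, ?_⟩
  -- the support of the pull-back is the preimage of the support (`t_R^♯ 1 = 1`)
  have hsec : Θ.IsSection 1 := h.isEffective.isSection_one
  have hpre := CartierDivisor.preimage_nonvanishing (𝒥.J.translation R).left hsec
  rw [map_one] at hpre
  rw [← hpre, ← Set.preimage_compl, hsupp, AbelianVariety.preimage_translation_eq_image_translation_inv,
    AbelianVariety.image_translation_image_translation_base]

end Jacobian

end Literature.AlgebraicGeometry.Motives

end
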